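import Summits.BirchSwinnertonDyer.BirchSwinnertonDyer.Theses.QuadraticBranchSignedControl
import Summits.BirchSwinnertonDyer.Rank1Residual.Additive.FouquetWanLocus
import Summits.BirchSwinnertonDyer.Rank1Residual.Additive.QuadraticBranchKatoBridge
import Summits.BirchSwinnertonDyer.BirchSwinnertonDyer.Theorems.QuadraticBranchSignedControlPlusEtaLowerInclusionRankZeroPairs
import Summits.BirchSwinnertonDyer.BirchSwinnertonDyer.Theorems.QuadraticBranchSignedControlPlusEtaLowerInclusionRung39675m1ByName
import Summits.BirchSwinnertonDyer.BirchSwinnertonDyer.Theorems.QuadraticBranchSignedControlPlusEtaLowerInclusionR0OfLowerBSDByName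
import Summits.BirchSwinnertonDyer.BirchSwinnertonDyer.Theorems.QuadraticBranchSignedControlPlusEtaLowerInclusionKuriharaCut
import HarnessLib

/-!
**v5 (planner bsd-potss-plan g26, 2026-08-28 — ADOPTED WITH ONE RESHAPE from seat k8eta-c1 g8's candidate, evidence #47/#48 on
stmt-BirchSwinnertonDyer-19601, mirror HOME/k8eta-c1/g8/PlusEtaLowerInclusion_birth_v5_candidate.lean sha16 003c706321cf9942).**
v5 = the REGISTERED v4 (sha `f52b9fac6fa9`; byte-identical below the v4 docstring except ONE added import) + a SECOND,
EVIDENCE-ALIGNED composition of the crux — THE KURIHARA CUT — over the seat's LANDED closer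
`PlusEtaKuriharaCut.plusEtaLowerInclusion_of_kim111_of_kuriharaData_of_tamagawaRows` (p599308). TWO content stubs added
(4 + 2 = 6 ≤ stubs_max 7), none removed, v4's `_of` (Fouquet–Wan locus cut) untouched and still primary for the audit:
* `stub_etaLower_kurihara_tamFree` (Σ₁ CONTENT stub): every Tamagawa-`p`-free globally minimal partner `W` of a tower-onto Gss2
  twist `V` (`p ≥ 5`) carries an admissible parametrisation datum (`p ∤ c_D`, `p`-unit period transfer — Manin's `c = ±1` for the
  optimal curve; Cremona for `N < 500000`) AND a unit Kurihara number at a cyclic `𝒩₁`-level — Manin's input + Kurihara's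
  conjecture mod `p` (Kim Conj. 1.9), verbatim the data binders of `PlusEtaKuriharaT0.etaPair_of_thm111_of_kuriharaUnit`;
  EVIDENCE (seat k8eta-c1 g5–g8, kit j260432/j261654/j282474/j283099/j283103): a unit Kurihara number on 2044/2044 (`p = 5`) +
  1040/1040 (`p = 7`) Tamagawa-free rank-one partners and 14/14 Tamagawa-free rank-zero census rows; the 20 Tamagawa-free
  tower-onto census rows (r0 14, r1 6) all carry a kernel record (`…PlusEtaKuriharaRecordsLocalTorsion01/02`, `…Rows07`);
  why_might_fail: a Tamagawa-free partner all of whose Kurihara numbers vanish mod `p` (none in 3098 computed rows), or `p ∣ c`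
  for an optimal curve at a prime of additive reduction (open beyond Cremona's range);
* `stub_etaLower_tamagawaRows` (CONTENT stub, the hardest of the cut): (E⁺_η) on the tower-onto pairs with `p ∣ ∏ c_ℓ(W)` —
  Kato's lower inclusion for `f_W` where Kim's criterion is void (Remark 6.2: 0/234 units); per row = Λ-primitivity of
  `κ^{Kato,∞}(W)` (Kim Thm. 1.4), no finite certificate known; 20 census rows (r1 15, r0 5), 19 certified only by LEVEL-ZERO
  instruments (Tamagawa road, Mordell–Weil road, level-2 Kurihara number, unit `Ш_an`), residue `69150v1`;
* `PlusEtaLowerInclusion_of_kuriharaCut (hKim) (hKur) (hTam)` / `plusEtaLowerInclusion_of_kim111_of_kuriharaStubs (hKim)`: the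
  crux BY NAME from the two stubs MODULO the named fact Kim 2026 Thm. 1.11 (1) ⟹ (3) at `η`
  (`Kim2026.thm111_etaEisensteinInclusion_of_kuriharaNumber_ne_zero`, p534181, flag `Kim26-111-eta-zeta-line`) in HYPOTHESIS
  position — one line over p599308.
THE RESHAPE (planner): the candidate's third stub `stub_etaLower_kim111 : Kim2026.thm111_… := by sorry` (a CITE-LEVEL input, «not
a prover target» in the seat's own words) is NOT registered: by the v4 rule of record (R136: registered stubs = the OPEN
mathematics only; published inputs enter as hypotheses of the compositions, exactly as Poitou–Tate / Kobayashi 2.2_η, 4.1_η /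
Kitajima–Otsuki 1.3 / modularity / GZK enter `etaLower_r0_of_stubs`) the named fact is a binder of the Kurihara-cut composition,
which keeps one stub slot free and no sorried cite in the registry. CURRENCY: the Tamagawa currency `p ∣ ∏ c_ℓ(W)` of p599308 is
kept (the records are keyed by it); the split-multiplicative currency is equivalent for `p ≥ 5` by p601509
`PlusEtaKuriharaCut.tamagawaFree_iff_forall_split` with the matching closer `…_of_splitRows` — a prover who prefers it files the
one-line transport, no re-registration needed. BY-NAME RULE (R136): the two new stubs are registered in `Sig.` form like v4's
four; a by-name closer of either needs a spelled-out re-registration first (ask the tenure planner on INBOX) — none is expected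
soon (both are class-wide open statements; per-row instances land as `--supports 19601` helpers). Farm: rc 0, SIX `sorry`s =
six stubs, 0 errors. HONEST FRAMING: conditional throughout; the crux, (E⁺) and BSD are exactly as open as before; nothing booked.
-/


/-!
# BC3 birth skeleton v4 — child crux `PlusEtaLowerInclusion` (item stmt-BirchSwinnertonDyer-19601, route K8
`QuadraticBranchSignedControl` rev 20; the OPEN CORE of the deciding crux (E⁺) `PlusLowerInclusionSurjBranch`
(19242) after the R102a glued split of rev 18: the Eisenstein ("lower") inclusion of Kobayashi's even main
conjecture AT `η = ω^{(p−1)/2}` — `Char(X⁺(V/K_∞)^η) ⊆ (L_p⁺(V, η, X))` VERBATIM on the `η`-component object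
(`QuadraticBranchPlusEtaLowerInclusionAt V p`, seat k8q-c2 g2) — on the `p`-adic-tower-onto Gss2 twists `V`
(good supersingular `a_p(V) = 0`, `p ≥ 5`); the descent frame 19602 and the held Kobayashi inputs 19603/19604
are the glue's other legs (19605 CLOSED); planner bsd-potss-plan g14, 2026-08-26)

= the parent's registered skeleton (`HOME/plan/percrux4/K8_PlusLowerInclusionSurjBranch_birth.lean`) moved
from the `ℚ(√p*)`-subtower currency to the print currency of the child, cut by the SAME locus:

* `stub_etaLower_fwLocus` — tower-onto twists INSIDE the Fouquet–Wan sub-locus of Gss2 (the additive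
  partner `W = V ⊗ χ_{p*}` has a non-split multiplicative prime with `W[p]` ramified and
  `SL₂(ℤ_p) ⊆ im ρ_{W,p^∞}`): the CLAIMED two-layer parent (Fouquet–Wan arXiv:2107.13726 Thm 5.1, PRE ⟹
  KMC(f_W) ⟹ the `η`-component by Kato Thm 12.5 / Kobayashi's proof of Thm 7.4 at `η`); open as a closed
  statement;
* `stub_etaLower_offLocus` — tower-onto twists OUTSIDE the sub-locus (e.g. prime-power conductor partners):
  the Eisenstein inclusion of the even signed main conjecture at `η ≠ 1` — nothing in print (the proved
  ±/Kato main conjectures sit on the trivial component of `Δ`);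
* `stub_etaLower_rung_39675m1` — BC5 PLAN-ONLY rung (J g4 add-1: «E⁺_η at ONE explicit Gss2 pair»): `V` =
  the good twist by `5* = 5` of `W₀ = 39675m1 = [0,−1,1,−506958,−159508807]` (Gss2 at `5`, `ρ̄` onto,
  `r_an = 0`, `ord₅ #Ш_an(W₀) = 2`, `ord₅ Tam = 0`; additive-p4 GEN 22 kit j135839: a UNIT Kurihara number at
  the cyclic pair level `n = 6541 = 31·211` ⟹ BSD₅(W₀) via Kim 2026 Thm 1.8 (6)); technique: BSD₅(W₀) exact
  ⟹ `ord₅ g_η(0) = ord₅ L_η(0)` through the `η`-transport + signed control (items 19583/19602) ⟹ with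
  Thm 4.1 (`n = 0`, tower onto) equality of ideals ⟹ (E⁺_η)(V); outside S's known regime for the additive
  `W₀` (no `p`-adic `L`-function at an additive prime) and OFF `L_{II*,5}` (Gss2 = `e = 2`, not II*). Not
  consumed by `_of`.

v2 (planner bsd-potss-plan g16, 2026-08-26, after k8-rung g0's p459681
`Theorems.quadraticBranchPlusEtaLowerInclusionAt_of_namedFacts_of_selmerWitness` / `_of_shaWitness` LANDED —
the CONVERSE road: on a tower-onto pair with `L(W,1) ≠ 0`, (E⁺_η)(V) FOLLOWS from the named facts Kobayashi
Thm 2.2_η / 4.1_η, Kitajima–Otsuki 1.3, modularity and the LOWER `p`-part of BSD for the additive partner `W`).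
Three stubs ADDED, none removed, `_of` unchanged (the locus cut stays primary; k8-fw's typed road targets
`stub_etaLower_fwLocus` verbatim):
* `stub_etaLower_rung_39675m1_inputs` — the BC5 rung in INPUTS form, SPELLED OUT (v3 = the header of k8-rung g0's
  by-name file `HOME/k8-rung/…Rung39675m1ByName.lean`, 20:03Z, VERBATIM: `W₀` as the literal, no `Sig` abbreviation, the
  three unused instance binders of v2 dropped): named facts Kobayashi 2.2_η / 4.1_η, Kitajima–Otsuki 1.3, modularity + the
  DISPLAYED row data of `W₀ = 39675m1` at `5` (`L(W₀,1) ≠ 0`; the Selmer-shape lower witness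
  `v₅(L(W₀,1)/Ω) ≤ ord₅ #Sel_{5^∞}(W₀)` = per row the output of Kim 2026 Thm 1.8 (6) on the unit Kurihara number of
  `X4.KimAdditiveRecordsExt.cert_X4ext_39675m1_p5`) ⟹ (E⁺_η) at `5` for every good twist of `W₀` — closes BY NAME from
  p461640 `Theorems.stub_etaLower_rung_39675m1_of_namedFacts_of_selmerWitness` (Kim-INPUT twin `…_of_kim` there too;
  `isGloballyMinimal_39675m1` / `isElliptic_39675m1` PROVED there). Closing it = the rung «closed modulo displayed
  per-row inputs»;
* `stub_etaLower_r0_lowerBSD` — the r_an(W) = 0 SUB-CUT of BOTH locus stubs, typed as what is really open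
  class-wide on it: L₀ = `MissingLowerBoundAt W p` (ord_p #Ш_an ≤ ord_p #Ш) on the Gss2 partners `W` of the
  tower-onto twists with `L(W,1) ≠ 0` — the K8 sibling of the L₀ cores 19618 (KT) / 19663 (K9); per pair = one
  unit Kurihara number (Kim), class-wide = Kato's lower inclusion for `f_W`; harvestable per pair by the kur seats;
* `stub_etaLower_r0_ofLowerBSD` — CONVERSE CONTROL modulo the named facts (v3: + Poitou–Tate duality `hPT`, needed on the
  `p ∣ Tam(W)` rows — k8-rung 19:48Z; = ctrl g4's landed `quadraticBranchPlusEtaLowerInclusionAt_of_missingLowerBoundAt_of_surjective`), in the cell's L₀ currency: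
  facts ⟹ (L₀(W) ⟹ (E⁺_η)(V)) on the r0 tower-onto pairs. On rows with `p ∤ Tam(W)` it is p459681
  `_of_shaWitness` + bookkeeping; on rows with `p ∣ Tam(W)` it needs the Tamagawa-carrying control (B.D. Kim's
  formula; ctrl g4 draft2 §3 `…_of_missingLowerBoundAt_of_surjective`) — ctrl's by-name target.
So on r0 rows 19601 ⟸ facts + L₀(W) (stubs r0_ofLowerBSD + r0_lowerBSD); rows with `L(W,1) = 0` stay on the
locus stubs only (the constant-term squeeze says nothing there).

v4 (planner bsd-potss-plan g17, 2026-08-26): the two DELIVERED legs leave the sorried stub set and are IMPORTED as the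
landed theorems they now are — `stub_etaLower_r0_ofLowerBSD` CLOSED BY NAME (p468146, seat ctrl g4,
`Theorems.PlusEtaLowerInclusionR0OfLowerBSD.stub_etaLower_r0_ofLowerBSD`, after ctrl's spelled-out re-registration) and
`stub_etaLower_rung_39675m1_inputs` DELIVERED IN SUBSTANCE by p465828 (seat k8-rung g0,
`Theorems.PlusEtaLowerInclusionRung39675m1.stub_etaLower_rung_39675m1_inputs`, accepted as a helper before the v3
registration; the verbatim alias p467151 bounced `dedup.landed`, so no by-name credit is attachable — the skeleton now USES
the theorem instead: `rung_39675m1_of_facts_of_inputs`). Registered stubs after v4 = the OPEN mathematics only: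
`stub_etaLower_fwLocus` · `stub_etaLower_offLocus` (primary cut, `_of`) · `stub_etaLower_rung_39675m1` (BC5 rung, now =
«4 named facts + `L(W₀,1) ≠ 0` + the Selmer-shape witness at `W₀`», `rung_39675m1_of_facts_of_inputs`) ·
`stub_etaLower_r0_lowerBSD` (L₀ on the r0 tower-onto partners; `etaLower_r0_of_stubs` composes it with the LANDED converse).

Sources: Kobayashi2003 (§4 Even MC, Thm 4.1, Thm 7.4), Kato2004Asterisque (Conj. 12.10, Thm 12.5),
FouquetWan2021 (arXiv:2107.13726, PRE), Kim2026 (AJM 148 Thm 1.8 (6)), PollackRubin2004.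
-/

noncomputable section

open scoped Classical

open CongruenceSubgroup Field WeierstrassCurve Literature.NumberTheory.EllipticCurves
open Literature.NumberTheory.EllipticCurves.ModularForms Literature.NumberTheory.GaloisRepresentations
open Literature.NumberTheory.GaloisCohomology
open Literature.NumberTheory.EllipticCurves.Rank1Residual
open Literature.NumberTheory.EllipticCurves.Rank1Residual.Typed
open Summit.BirchSwinnertonDyer.Rank1Residual Summit.BirchSwinnertonDyer.Rank1Residual.Additive
open Summit.BirchSwinnertonDyer.BirchSwinnertonDyer.Theses.QuadraticBranchSignedControl
open Summit.BirchSwinnertonDyer.BirchSwinnertonDyer.Theorems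

namespace Summit.BirchSwinnertonDyer.BirchSwinnertonDyer.Cruxes.PlusEtaLowerInclusion.Birth

/-- The Fouquet–Wan sub-locus of Gss2, read on the good twist `V` at `p` (verbatim the parent skeleton's). -/
abbrev FWLocus (V : WeierstrassCurve ℚ) [V.IsElliptic] (p : ℕ) [Fact p.Prime] : Prop :=
  ∃ (W : WeierstrassCurve ℚ) (_ : W.IsElliptic) (_ : W.IsGloballyMinimal) (C : VariableChange ℚ),
    C • W.quadraticTwist ((-1) ^ (p / 2) * p) = V ∧ Addv W p ∧ SubGss W p ∧
      FWNonsplitRam W p ∧ Kato2004.ImageContainsSL2 W p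

/-- The explicit Gss2 partner of the BC5 rung: `39675m1` (Cremona), minimal model `[0,−1,1,−506958,−159508807]`. -/
def W39675m1 : WeierstrassCurve ℚ := ⟨0, -1, 1, -506958, -159508807⟩

/-- Statement of `stub_etaLower_fwLocus`: (E⁺_η) on the tower-onto twists INSIDE the Fouquet–Wan sub-locus.
[cite: FouquetWan2021, Thm. 5.1 (PRE)] [cite: Kobayashi2003, Thm. 7.4 proof (p. 13)] -/
abbrev Sig.stub_etaLower_fwLocus : Prop :=
  ∀ (V : WeierstrassCurve ℚ) [V.IsElliptic] [V.IsGloballyMinimal] (p : ℕ) [Fact p.Prime],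
    5 ≤ p → V.HasGoodReductionAtPrime p → V.frobeniusTrace p = 0 →
    (∀ m : ℕ, V.HasSurjectiveModNGaloisRep (p ^ m : ℕ)) → FWLocus V p →
      QuadraticBranchPlusEtaLowerInclusionAt V p

/-- Statement of `stub_etaLower_offLocus`: (E⁺_η) on the tower-onto twists OUTSIDE the Fouquet–Wan
sub-locus — nothing in print. [cite: Kobayashi2003, §4 Even main conjecture (p. 8)] -/
abbrev Sig.stub_etaLower_offLocus : Prop :=
  ∀ (V : WeierstrassCurve ℚ) [V.IsElliptic] [V.IsGloballyMinimal] (p : ℕ) [Fact p.Prime],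
    5 ≤ p → V.HasGoodReductionAtPrime p → V.frobeniusTrace p = 0 →
    (∀ m : ℕ, V.HasSurjectiveModNGaloisRep (p ^ m : ℕ)) → ¬ FWLocus V p →
      QuadraticBranchPlusEtaLowerInclusionAt V p

/-- Statement of the BC5 PLAN-ONLY rung `stub_etaLower_rung_39675m1`: (E⁺_η) at `p = 5` for the good twist
`V` of `W₀ = 39675m1` by `5* = 5` (one explicit Gss2 pair; not consumed by `_of`).
[cite: Kim2026, Thm. 1.8 (6)] [cite: Kobayashi2003, Thm. 1.2, Thm. 4.1] -/
abbrev Sig.stub_etaLower_rung_39675m1 : Prop :=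
  ∀ (V : WeierstrassCurve ℚ) [V.IsElliptic] [V.IsGloballyMinimal] [Fact (5 : ℕ).Prime],
    (∃ C : VariableChange ℚ, C • W39675m1.quadraticTwist 5 = V) →
    V.HasGoodReductionAtPrime 5 → V.frobeniusTrace 5 = 0 →
    (∀ m : ℕ, V.HasSurjectiveModNGaloisRep (5 ^ m : ℕ)) →
      QuadraticBranchPlusEtaLowerInclusionAt V 5

/-- Statement of `stub_etaLower_r0_lowerBSD` (v2): L₀ — `ord_p #Ш(W)_an ≤ ord_p #Ш(W)` (`MissingLowerBoundAt`) —
on the additive Gss2 partners `W` (`C • W^{(p*)} = V`) of the `p`-adic-tower-onto good supersingular twists `V`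
(`a_p(V) = 0`, `p ≥ 5`) with `L(W,1) ≠ 0`. Class-wide = Kato's lower inclusion for `f_W` (open); per pair = one
unit Kurihara number (Kim 2026 Thm 1.8 (6)). [cite: Kato2004Asterisque, Conj. 12.10] [cite: Kim2026, Thm. 1.8 (6)] -/
abbrev Sig.stub_etaLower_r0_lowerBSD : Prop :=
  ∀ (V : WeierstrassCurve ℚ) [V.IsElliptic] [V.IsGloballyMinimal] (W : WeierstrassCurve ℚ) [W.IsElliptic]
    [W.IsGloballyMinimal] (C : VariableChange ℚ) (p : ℕ) [Fact p.Prime],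
    5 ≤ p → C • W.quadraticTwist ((-1) ^ (p / 2) * p) = V →
    V.HasGoodReductionAtPrime p → V.frobeniusTrace p = 0 →
    (∀ m : ℕ, V.HasSurjectiveModNGaloisRep (p ^ m : ℕ)) → W.entireLFunction 1 ≠ 0 →
      MissingLowerBoundAt W p

theorem stub_etaLower_fwLocus : Sig.stub_etaLower_fwLocus := by
  sorry

theorem stub_etaLower_offLocus : Sig.stub_etaLower_offLocus := by
  sorry

theorem stub_etaLower_rung_39675m1 : Sig.stub_etaLower_rung_39675m1 := by
  sorry

theorem stub_etaLower_r0_lowerBSD : Sig.stub_etaLower_r0_lowerBSD := by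
  sorry

/-- The BC5 rung from its INPUTS form (LANDED, p465828) — what the registered rung stub still owes: the four named facts
(Kobayashi 2.2_η / 4.1_η, Kitajima–Otsuki 1.3, modularity) and the two displayed row data of `W₀ = 39675m1` at `5`
(`L(W₀,1) ≠ 0`; the Selmer-shape lower witness `v₅(L(W₀,1)/Ω) ≤ ord₅ #Sel_{5^∞}(W₀)`). No sorry. -/
theorem rung_39675m1_of_facts_of_inputs
    (h22 : Kobayashi2003.thm22_etaSignedSelmerDual_finite_torsion)
    (h41 : Kobayashi2003.thm41_plusEtaCharIdeal_dvd)
    (hKO : KitajimaOtsuki2018.mainThm13_etaSignedSelmerDual_noFiniteSubmodule)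
    (hmod : hasEntireLFunction_rat) (hLW : W39675m1.entireLFunction 1 ≠ 0)
    (hwit : ∃ q : ℚ, W39675m1.entireLFunction 1 / (W39675m1.realPeriodRat : ℂ) = (q : ℂ) ∧
      padicValRat 5 q ≤ (padicValNat 5 (Nat.card ↥(W39675m1.selmerGroupPInfty 5)) : ℤ)) :
    Sig.stub_etaLower_rung_39675m1 := by
  intro V _ _ _ hC hg ha hs
  exact PlusEtaLowerInclusionRung39675m1.stub_etaLower_rung_39675m1_inputs h22 h41 hKO hmod hLW hwit V hC hg ha hs

/-- The r0 sub-cut composed (v4): on a tower-onto pair with `L(W,1) ≠ 0`, (E⁺_η)(V) from the L₀ stub, the LANDED converse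
control (p468146 `PlusEtaLowerInclusionR0OfLowerBSD.stub_etaLower_r0_ofLowerBSD`, ctrl g4) and the named facts — records that
`stub_etaLower_r0_lowerBSD` ALONE now covers the r0 rows of BOTH locus stubs modulo Poitou–Tate, Kobayashi 2.2_η / 4.1_η,
Kitajima–Otsuki 1.3, modularity, GZK. -/
theorem etaLower_r0_of_stubs (hlow : Sig.stub_etaLower_r0_lowerBSD)
    (hPT : poitouTate_selmerStructure_duality_real ℚ)
    (h22 : Kobayashi2003.thm22_etaSignedSelmerDual_finite_torsion)
    (h41 : Kobayashi2003.thm41_plusEtaCharIdeal_dvd)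
    (hKO : KitajimaOtsuki2018.mainThm13_etaSignedSelmerDual_noFiniteSubmodule)
    (hmod : hasEntireLFunction_rat) (hGZK : rank_eq_analyticRank_of_analyticRank_le_one)
    (V : WeierstrassCurve ℚ) [V.IsElliptic] [V.IsGloballyMinimal] (W : WeierstrassCurve ℚ) [W.IsElliptic]
    [W.IsGloballyMinimal] (C : VariableChange ℚ) (p : ℕ) [Fact p.Prime] (h5 : 5 ≤ p)
    (hCV : C • W.quadraticTwist ((-1) ^ (p / 2) * p) = V) (hg : V.HasGoodReductionAtPrime p)
    (ha : V.frobeniusTrace p = 0) (hs : ∀ m : ℕ, V.HasSurjectiveModNGaloisRep (p ^ m : ℕ))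
    (hL : W.entireLFunction 1 ≠ 0) : QuadraticBranchPlusEtaLowerInclusionAt V p :=
  PlusEtaLowerInclusionR0OfLowerBSD.stub_etaLower_r0_ofLowerBSD hPT h22 h41 hKO hmod hGZK V W C p h5 hCV hg ha hs hL
    (hlow V W C p h5 hCV hg ha hs hL)

/-- The locus split gives the child crux BY NAME. -/
theorem PlusEtaLowerInclusion_of (hfw : Sig.stub_etaLower_fwLocus) (hoff : Sig.stub_etaLower_offLocus) :
    PlusEtaLowerInclusion := by
  intro V _ _ p _ h5 hg ha hs
  by_cases hL : FWLocus V p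
  · exact hfw V p h5 hg ha hs hL
  · exact hoff V p h5 hg ha hs hL

/-- The child crux from the (sorried) stubs — records that the stub set is complete. -/
theorem plusEtaLowerInclusion_of_stubs : PlusEtaLowerInclusion :=
  PlusEtaLowerInclusion_of stub_etaLower_fwLocus stub_etaLower_offLocus


/-! ## v5 — THE KURIHARA CUT (seat k8eta-c1 g8, adopted by planner g26; over p599308 `PlusEtaKuriharaCut`; Kim 1.11_η in hypothesis position) -/

/-- Statement of `stub_etaLower_kurihara_tamFree` (Σ₁ content stub): every Tamagawa-`p`-free globally minimal partner `W`
(`C • W^{(p*)} = V`) of a tower-onto good supersingular `a_p = 0` twist `V`, `p ≥ 5`, carries SOME modular parametrisation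
datum `D` with `p ∤ c_D` and a `p`-unit period transfer, and SOME cyclic `𝒩₁`-level `n` with surjective characters `ψ` and a
unit Kurihara number `δ̃_n(D.f, ψ) ≠ 0` — Manin's input + Kurihara's conjecture mod `p`, verbatim the data binders of the road
`PlusEtaKuriharaT0.etaPair_of_thm111_of_kuriharaUnit`. [cite: Kim2022StructureSelmer, Conj. 1.9, §1.3.5, Remark 6.2]
[cite: CesnaviciusNeururerSaha2023, §1 (Cremona's Manin data)] -/
abbrev Sig.stub_etaLower_kurihara_tamFree : Prop :=
  ∀ (V : WeierstrassCurve ℚ) [V.IsElliptic] [V.IsGloballyMinimal] (W : WeierstrassCurve ℚ)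
    [W.IsElliptic] [W.IsGloballyMinimal] (C : VariableChange ℚ) (p : ℕ) [Fact p.Prime],
    5 ≤ p → C • W.quadraticTwist ((-1) ^ (p / 2) * p) = V → V.HasGoodReductionAtPrime p →
    V.frobeniusTrace p = 0 → (∀ m : ℕ, V.HasSurjectiveModNGaloisRep (p ^ m : ℕ)) →
    ¬ p ∣ W.tamagawaProduct →
    ∃ (NW : ℕ) (_ : NeZero NW) (D : ModularParametrizationData W NW),
      ¬ (p : ℤ) ∣ D.maninConstant ∧
      (∃ u : ℚ, ‖(u : ℚ_[p])‖ = 1 ∧ W.realPeriodRat = u * plusPeriod D.f) ∧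
      ∃ (n : ℕ) (_ : NeZero n), Kato.IsKolyvaginProduct W p 1 n ∧
        (∀ (ℓ : ℕ) [Fact ℓ.Prime], ℓ ∣ n →
          Nat.card {P : ((WeierstrassCurve.integralModelInt W).map
            (Int.castRingHom (ZMod ℓ))).toAffine.Point // p • P = 0} ≤ p) ∧
        ∃ ψ : (ℓ : ℕ) → (ZMod ℓ)ˣ →* Multiplicative (ZMod p),
          (∀ ℓ ∈ n.primeFactors, Function.Surjective (ψ ℓ)) ∧ kuriharaNumber D.f p n ψ ≠ 0

/-- Statement of `stub_etaLower_tamagawaRows` (content stub, hardest): (E⁺_η) on the tower-onto pairs whose globally minimal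
partner `W` has `p ∣ ∏ c_ℓ(W)` — Kato's lower inclusion for `f_W` on the Tamagawa rows (Kim Thm. 1.4: Λ-primitivity of
`κ^{Kato,∞}(W)`; no finite certificate known). [cite: Kim2022StructureSelmer, Thm. 1.4, Remark 6.2]
[cite: Kato2004Asterisque, Conj. 12.10] [cite: Kobayashi2003, §4 Even main conjecture (p. 8)] -/
abbrev Sig.stub_etaLower_tamagawaRows : Prop :=
  ∀ (V : WeierstrassCurve ℚ) [V.IsElliptic] [V.IsGloballyMinimal] (W : WeierstrassCurve ℚ)
    [W.IsElliptic] [W.IsGloballyMinimal] (C : VariableChange ℚ) (p : ℕ) [Fact p.Prime],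
    5 ≤ p → C • W.quadraticTwist ((-1) ^ (p / 2) * p) = V → V.HasGoodReductionAtPrime p →
    V.frobeniusTrace p = 0 → (∀ m : ℕ, V.HasSurjectiveModNGaloisRep (p ^ m : ℕ)) →
    p ∣ W.tamagawaProduct → QuadraticBranchPlusEtaLowerInclusionAt V p

theorem stub_etaLower_kurihara_tamFree : Sig.stub_etaLower_kurihara_tamFree := by
  sorry

theorem stub_etaLower_tamagawaRows : Sig.stub_etaLower_tamagawaRows := by
  sorry

/-- Composition (v5, the Kurihara cut): the child crux BY NAME from the Σ₁ Kurihara datum on the Tamagawa-free partners + the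
Tamagawa rows, MODULO the named fact Kim 2026 Thm. 1.11 (1) ⟹ (3) at `η` (`hKim`, hypothesis position; p534181) — one line over
the seat's landed closer `PlusEtaKuriharaCut.plusEtaLowerInclusion_of_kim111_of_kuriharaData_of_tamagawaRows` (p599308).
[cite: Kim2022StructureSelmer, Thm. 1.11 (PDF p. 8), Conj. 1.9, Remark 6.2] -/
theorem PlusEtaLowerInclusion_of_kuriharaCut
    (hKim : Kim2026.thm111_etaEisensteinInclusion_of_kuriharaNumber_ne_zero)
    (hKur : Sig.stub_etaLower_kurihara_tamFree) (hTam : Sig.stub_etaLower_tamagawaRows) :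
    PlusEtaLowerInclusion :=
  PlusEtaKuriharaCut.plusEtaLowerInclusion_of_kim111_of_kuriharaData_of_tamagawaRows hKim hKur hTam

/-- The child crux from the (sorried) stubs of the Kurihara cut, modulo Kim 1.11_η — records that this stub set is complete
too (given the named fact). -/
theorem plusEtaLowerInclusion_of_kim111_of_kuriharaStubs
    (hKim : Kim2026.thm111_etaEisensteinInclusion_of_kuriharaNumber_ne_zero) : PlusEtaLowerInclusion :=
  PlusEtaLowerInclusion_of_kuriharaCut hKim stub_etaLower_kurihara_tamFree stub_etaLower_tamagawaRows

end Summit.BirchSwinnertonDyer.BirchSwinnertonDyer.Cruxes.PlusEtaLowerInclusion.Birth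

end
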